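import Literature.MathematicalPhysics.QuantumFieldTheory.Sweep1AreaLawProofs
import Literature.MathematicalPhysics.QuantumLattice.WilsonLoops
import Literature.MathematicalPhysics.QuantumLattice.LatticeGaugeDLR
import Literature.Probability.LatticeModels.ProductMeasureTools
import HarnessLib

/-!
# Transfer of free-boundary cube integrals to the discrete torus (periodisation)

Bookkeeping used to compare Sweep1's free-boundary lattice gauge theory on a region `Λ ⊆ ℤ^d`
(`zdWilsonMeasure ρ β Λ`, a probability measure on `G^{E(ℤ^d)}` built on the infinite product
Haar measure `zdHaar`) with Wave 0's theory on the discrete torus `(ℤ/Lℤ)^d`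
(`wilsonMeasure ρ β`, built on the finite product Haar measure), through the periodic lift
`torusLift L : G^{E((ℤ/Lℤ)^d)} → G^{E(ℤ^d)}` of `LatticeGaugeDLR`:

* periodisation identities `line/rectangle/plaquette (torusLift L U) = …Holonomy U (proj ·)`,
  hence `zdWilsonLoop ρ x i j R T ∘ torusLift L = wilsonLoop ρ (proj x) i j R T` and the formula
  for `zdWilsonAction ρ Λ ∘ torusLift L`;
* the support of the free-boundary action (`dependsOn_zdWilsonAction`); injectivity of `Torus.proj (L+1)` on the cube `box d n` for `2n ≤ L`, and of `torusEdge` on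
  edge sets based in the cube (bonds of cube plaquettes, bonds of a loop at the origin);
* **the marginal lemma** `map_comp_pi_of_injective`: the image of a finite product of copies of
  a probability measure under `U ↦ U ∘ τ` for an injective `τ` is the product over the source
  index type; whence **the transfer lemma** `integral_torusLift_eq_integral_zdHaar`:
  `∫ F (torusLift L U) dHaar^{E(torus)}(U) = ∫ F dg_∞` for every measurable `F` depending only on
  a finite edge set on which `torusEdge L` is injective;
* the torus expectation as a ratio of integrals (`wilsonExpectation_eq_div_integral`).

All statements are [folklore]; they serve the discharge of
`Literature.MathematicalPhysics.QuantumFieldTheory.GinibreU1TorusGeFreeBoxD4`.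
-/

noncomputable section

open MeasureTheory Filter Finset
open Literature.Probability.LatticeModels Literature.MathematicalPhysics.QuantumLattice

namespace Literature.MathematicalPhysics.QuantumFieldTheory

open AreaLaw

variable {d N : ℕ} {G : Type*}

/-! ### Periodisation identities -/

/-- The periodic lift reads the torus configuration at the projected edge. [folklore] -/
theorem torusLift_apply (L : ℕ) (U : GaugeConfig d L G) (e : ZdEdge d) :
    torusLift L U e = U (Torus.proj L e.1, e.2) := rfl

variable [Group G]

/-- Straight-path holonomies of the periodic lift are Wave 0's `lineHolonomy` on the torus.
[folklore] -/
theorem line_torusLift (L : ℕ) (U : GaugeConfig d L G) (k : Fin d) :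
    ∀ (n : ℕ) (y : Literature.Probability.LatticeModels.Site d),
      ZdGaugeConfig.line (torusLift L U) k n y = lineHolonomy U k n (Torus.proj L y)
  | 0, _ => rfl
  | n + 1, y => by
    rw [ZdGaugeConfig.line, lineHolonomy, line_torusLift L U k n, torusLift_apply, Site.shift,
      torusProj_add_single, Int.cast_one]

/-- Rectangular holonomies of the periodic lift are Wave 0's `rectangleHolonomy`. [folklore] -/
theorem rectangle_torusLift (L : ℕ) (U : GaugeConfig d L G)
    (x : Literature.Probability.LatticeModels.Site d) (i j : Fin d) (R T : ℕ) :
    ZdGaugeConfig.rectangle (torusLift L U) x i j R T =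
      rectangleHolonomy U (Torus.proj L x) i j R T := by
  simp only [ZdGaugeConfig.rectangle, rectangleHolonomy, line_torusLift, torusProj_add_single,
    Int.cast_natCast]

/-- Plaquette holonomies of the periodic lift are Wave 0's `plaquetteHolonomy`. [folklore] -/
theorem plaquette_torusLift (L : ℕ) (U : GaugeConfig d L G)
    (x : Literature.Probability.LatticeModels.Site d) (k l : Fin d) :
    ZdGaugeConfig.plaquette (torusLift L U) x k l = plaquetteHolonomy U (Torus.proj L x) k l := by
  simp only [ZdGaugeConfig.plaquette, plaquetteHolonomy, torusLift_apply, Site.shift,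
    torusProj_add_single, Int.cast_one]

variable (ρ : G →* Matrix (Fin N) (Fin N) ℂ)

/-- `W_{R×T} ∘ torusLift = W^{torus}_{R×T}` (Sweep1's free-lattice Wilson loop read on periodic
configurations is Wave 0's torus Wilson loop). [folklore] -/
theorem zdWilsonLoop_torusLift (L : ℕ) (U : GaugeConfig d L G)
    (x : Literature.Probability.LatticeModels.Site d) (i j : Fin d) (R T : ℕ) :
    zdWilsonLoop ρ x i j R T (torusLift L U) = wilsonLoop ρ (Torus.proj L x) i j R T U := by
  simp only [zdWilsonLoop, wilsonLoop, rectangle_torusLift]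

/-- The free-boundary action of `Λ` read on a periodic configuration. [folklore] -/
theorem zdWilsonAction_torusLift (L : ℕ) (U : GaugeConfig d L G)
    (Λ : Finset (Literature.Probability.LatticeModels.Site d)) :
    zdWilsonAction ρ Λ (torusLift L U) =
      ∑ p ∈ plaquettesIn Λ,
        ((N : ℝ) - (ρ (plaquetteHolonomy U (Torus.proj L p.1) p.2.1 p.2.2)).trace.re) := by
  simp only [zdWilsonAction, plaquette_torusLift]

/-- The free-boundary action of `Λ` depends only on the bonds of the plaquettes of `Λ`.
[folklore] -/
theorem dependsOn_zdWilsonAction (Λ : Finset (Literature.Probability.LatticeModels.Site d)) :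
    DependsOn (zdWilsonAction (d := d) ρ Λ)
      (((plaquettesIn Λ).biUnion Plaq.bonds : Finset (ZdEdge d)) : Set (ZdEdge d)) := by
  intro U V h
  unfold zdWilsonAction
  refine Finset.sum_congr rfl fun p hp => ?_
  have e : ZdGaugeConfig.plaquette U p.1 p.2.1 p.2.2 = ZdGaugeConfig.plaquette V p.1 p.2.1 p.2.2 :=
    dependsOn_plaquette_bonds p fun e he =>
      h e (Finset.mem_coe.2 (Finset.mem_biUnion.2 ⟨p, hp, Finset.mem_coe.1 he⟩))
  rw [e]

/-! ### Injectivity of the projection on a cube -/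

omit [Group G] in
/-- `Torus.proj (L+1)` is injective on the cube `{-n,…,n}^d` when `2n ≤ L` (cf. the pointwise
form `Literature.Probability.LatticeModels.torusProj_injOn_box` of `LroInfraredBound`, not in
this file's import closure). [folklore] -/
theorem torusProj_succ_injOn_box {n L : ℕ} (h : 2 * n ≤ L) :
    Set.InjOn (Torus.proj (d := d) (L + 1))
      (box d n : Set (Literature.Probability.LatticeModels.Site d)) := by
  intro x hx y hy hxy
  funext k
  have hk : ((x k : ℤ) : ZMod (L + 1)) = ((y k : ℤ) : ZMod (L + 1)) := congrFun hxy k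
  rw [ZMod.intCast_eq_intCast_iff_dvd_sub] at hk
  obtain ⟨hx1, hx2⟩ := mem_box.1 (Finset.mem_coe.1 hx) k
  obtain ⟨hy1, hy2⟩ := mem_box.1 (Finset.mem_coe.1 hy) k
  have hL : (2 * n : ℤ) ≤ L := by exact_mod_cast h
  have hlt : |y k - x k| < ((L + 1 : ℕ) : ℤ) := by
    rw [abs_lt]; push_cast; constructor <;> linarith
  have h0 := Int.eq_zero_of_abs_lt_dvd hk hlt
  linarith

omit [Group G] in
/-- `torusEdge (L+1)` is injective on every edge set based in the cube `{-n,…,n}^d`, `2n ≤ L`.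
[folklore] -/
theorem torusEdge_injOn {n L : ℕ} (h : 2 * n ≤ L) {S : Finset (ZdEdge d)}
    (hS : ∀ e ∈ S, e.1 ∈ box d n) : Set.InjOn (torusEdge (d := d) (L + 1)) S := by
  intro e he e' he' hee'
  simp only [torusEdge, Prod.mk.injEq] at hee'
  exact Prod.ext (torusProj_succ_injOn_box h (Finset.mem_coe.2 (hS e he))
    (Finset.mem_coe.2 (hS e' he')) hee'.1) hee'.2

omit [Group G] in
/-- A point `s eᵢ + t eⱼ` (`i ≠ j`) with `0 ≤ s, t ≤ n` lies in the cube `{-n,…,n}^d`. [folklore] -/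
theorem single_add_single_mem_box {n : ℕ} {i j : Fin d} (hij : i ≠ j) {s t : ℤ} (hs0 : 0 ≤ s)
    (hs : s ≤ n) (ht0 : 0 ≤ t) (ht : t ≤ n) :
    (Pi.single i s + Pi.single j t : Literature.Probability.LatticeModels.Site d) ∈ box d n := by
  rw [mem_box]
  intro k
  simp only [Pi.add_apply, Pi.single_apply]
  by_cases hki : k = i
  · have hkj : k ≠ j := fun hkj => hij (hki.symm.trans hkj)
    simp only [hki, if_true, if_neg (show i ≠ j from hij)]
    constructor <;> linarith
  · by_cases hkj : k = j
    · simp only [hkj, if_neg (Ne.symm hij), if_true]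
      constructor <;> linarith
    · simp only [if_neg hki, if_neg hkj]
      constructor <;> linarith

omit [Group G] in
/-- The bonds of the `R × T` loop at the origin in the `(i, j)` plane (`i ≠ j`, `R, T ≤ n`) are
based in the cube `{-n,…,n}^d`. [folklore] -/
theorem fst_mem_box_of_mem_loopEdges {n : ℕ} {i j : Fin d} (hij : i ≠ j) {R T : ℕ} (hR : R ≤ n)
    (hT : T ≤ n) {e : ZdEdge d} (he : e ∈ loopEdges (0 : Literature.Probability.LatticeModels.Site d) i j R T) :
    e.1 ∈ box d n := by
  simp only [loopEdges, Finset.mem_union] at he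
  rcases he with ((he | he) | he) | he
  · obtain ⟨t, ht, rfl⟩ := mem_lineEdges_iff.1 he
    have : (0 : Literature.Probability.LatticeModels.Site d) + Pi.single i (t : ℤ) =
        Pi.single i (t : ℤ) + Pi.single j (0 : ℤ) := by simp
    rw [this]
    exact single_add_single_mem_box hij (by positivity) (by exact_mod_cast ht.le.trans hR)
      le_rfl (by positivity)
  · obtain ⟨t, ht, rfl⟩ := mem_lineEdges_iff.1 he
    rw [zero_add]
    exact single_add_single_mem_box hij (by positivity) (by exact_mod_cast hR) (by positivity)
      (by exact_mod_cast ht.le.trans hT)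
  · obtain ⟨t, ht, rfl⟩ := mem_lineEdges_iff.1 he
    rw [zero_add, add_comm]
    exact single_add_single_mem_box hij (by positivity) (by exact_mod_cast ht.le.trans hR)
      (by positivity) (by exact_mod_cast hT)
  · obtain ⟨t, ht, rfl⟩ := mem_lineEdges_iff.1 he
    have : (0 : Literature.Probability.LatticeModels.Site d) + Pi.single j (t : ℤ) =
        Pi.single i (0 : ℤ) + Pi.single j (t : ℤ) := by simp
    rw [this]
    exact single_add_single_mem_box hij le_rfl (by positivity) (by positivity)
      (by exact_mod_cast ht.le.trans hT)

/-! ### The marginal lemma and the transfer lemma -/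

omit [Group G] in
/-- **Marginal of a product measure along an injection.** For finite index types, a probability
measure `ν` and an injective `τ : S → E`, the image of `ν^{⊗E}` under `U ↦ U ∘ τ` is `ν^{⊗S}`
(the coordinates `U(τ s)` are independent with law `ν`). [folklore] -/
theorem map_comp_pi_of_injective {E S Y : Type*} [Fintype E] [Fintype S] [MeasurableSpace Y]
    (ν : Measure Y) [IsProbabilityMeasure ν] {τ : S → E} (hτ : Function.Injective τ) :
    (Measure.pi fun _ : E => ν).map (fun (U : E → Y) (s : S) => U (τ s)) =
      Measure.pi fun _ : S => ν := by
  classical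
  have hmeas : Measurable fun (U : E → Y) (s : S) => U (τ s) :=
    measurable_pi_lambda _ fun s => measurable_pi_apply _
  symm
  refine Measure.pi_eq fun A hA => ?_
  rw [Measure.map_apply hmeas (MeasurableSet.univ_pi hA)]
  let B : E → Set Y := fun e => if h : ∃ s, τ s = e then A h.choose else Set.univ
  have hpre : (fun (U : E → Y) (s : S) => U (τ s)) ⁻¹' Set.pi Set.univ A = Set.pi Set.univ B := by
    ext U
    simp only [Set.mem_preimage, Set.mem_univ_pi]
    constructor
    · intro hU e
      by_cases h : ∃ s, τ s = e
      · have h1 := hU h.choose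
        rw [h.choose_spec] at h1
        simp only [B, dif_pos h]
        exact h1
      · simp only [B, dif_neg h, Set.mem_univ]
    · intro hU s
      have h : ∃ s', τ s' = τ s := ⟨s, rfl⟩
      have h1 := hU (τ s)
      simp only [B, dif_pos h] at h1
      rwa [hτ h.choose_spec] at h1
  rw [hpre, Measure.pi_pi]
  have hprod : ∏ e, ν (B e) = ∏ e ∈ Finset.univ.image τ, ν (B e) := by
    symm
    refine Finset.prod_subset (Finset.subset_univ _) fun e _ he => ?_
    have h : ¬ ∃ s, τ s = e := fun ⟨s, hs⟩ =>
      he (Finset.mem_image.2 ⟨s, Finset.mem_univ _, hs⟩)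
    simp only [B, dif_neg h, measure_univ]
  rw [hprod, Finset.prod_image fun s _ s' _ hss' => hτ hss']
  refine Finset.prod_congr rfl fun s _ => ?_
  have h : ∃ s', τ s' = τ s := ⟨s, rfl⟩
  simp only [B, dif_pos h, hτ h.choose_spec]

variable [TopologicalSpace G] [IsTopologicalGroup G]

/-- The Wilson action of the torus is continuous for continuous `ρ`. [folklore] -/
theorem continuous_wilsonAction {L : ℕ} [NeZero L] (hρ : Continuous ρ) :
    Continuous (wilsonAction (d := d) (L := L) ρ) := by
  unfold wilsonAction
  refine continuous_finsetSum _ fun p _ => ?_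
  have h1 : Continuous fun U : GaugeConfig d L G => plaquetteHolonomy U p.1 p.2.1.1 p.2.1.2 := by
    unfold plaquetteHolonomy; fun_prop
  have h2 : Continuous fun U : GaugeConfig d L G =>
      (ρ (plaquetteHolonomy U p.1 p.2.1.1 p.2.1.2)).trace.re :=
    Complex.continuous_re.comp (hρ.comp h1).matrix_trace
  exact continuous_const.sub h2

variable [CompactSpace G] [MeasurableSpace G] [BorelSpace G]

/-- **Transfer lemma.** If `F : G^{E(ℤ^d)} → ℝ` is measurable and depends only on the edges of a
finite set `S` on which `torusEdge L` is injective, then its integral against the periodised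
torus Haar measure equals its integral against `dg_∞`: both are the integral of the induced
function on `G^S` against `Haar^{⊗S}`. [folklore] -/
theorem integral_torusLift_eq_integral_zdHaar {L : ℕ} [NeZero L] {S : Finset (ZdEdge d)}
    (hinj : Set.InjOn (torusEdge (d := d) L) S) {F : ZdGaugeConfig d G → ℝ} (hFm : Measurable F)
    (hdep : DependsOn F (S : Set (ZdEdge d))) :
    ∫ U, F (torusLift L U) ∂(Measure.pi fun _ : Edge d L => haarProbability G) =
      ∫ U, F U ∂(zdHaar d G) := by
  classical
  obtain ⟨F', hF'm, hFF'⟩ :=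
    exists_measurable_comp_restrict S (1 : ZdGaugeConfig d G) hFm hdep
  -- the torus side: `F ∘ torusLift = F' ∘ (U ↦ (s ↦ U (torusEdge L s)))`
  have hτ : Function.Injective fun s : ↥S => torusEdge (d := d) L s := by
    intro s s' h
    exact Subtype.ext (hinj s.2 s'.2 h)
  have hm : Measurable fun (U : Edge d L → G) (s : ↥S) => U (torusEdge (d := d) L s) :=
    measurable_pi_lambda _ fun s => measurable_pi_apply _
  have h1 : ∫ U, F (torusLift L U) ∂(Measure.pi fun _ : Edge d L => haarProbability G) =
      ∫ u, F' u ∂(Measure.pi fun _ : ↥S => haarProbability G) := by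
    rw [← map_comp_pi_of_injective (haarProbability G) hτ, integral_map hm.aemeasurable
      hF'm.aestronglyMeasurable]
    rw [hFF']
    rfl
  -- the `ℤ^d` side: `F = F' ∘ S.restrict` and `infinitePi_map_restrict`
  have h2 : ∫ U, F U ∂(zdHaar d G) = ∫ u, F' u ∂(Measure.pi fun _ : ↥S => haarProbability G) := by
    rw [zdHaar, ← Measure.infinitePi_map_restrict (μ := fun _ : ZdEdge d => haarProbability G)
      (I := S), integral_map (Finset.measurable_restrict S).aemeasurable hF'm.aestronglyMeasurable]
    rw [hFF']
    rfl
  rw [h1, h2]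

/-! ### Torus expectations as ratios of integrals -/

/-- **Torus expectations as ratios.** For continuous `ρ`,
`⟨F⟩_{Λ_L,β} = ∫ F e^{-β S} dHaar^{⊗E} / ∫ e^{-β S} dHaar^{⊗E}` (Seiler LNP 159 §1). [folklore] -/
theorem wilsonExpectation_eq_div_integral {L : ℕ} [NeZero L] [SecondCountableTopology G]
    (hρ : Continuous ρ) (β : ℝ) (F : GaugeConfig d L G → ℝ) :
    wilsonExpectation ρ β F =
      (∫ U, F U * Real.exp (-β * wilsonAction ρ U) ∂Measure.pi fun _ : Edge d L => haarProbability G) /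
        ∫ U, Real.exp (-β * wilsonAction ρ U) ∂Measure.pi fun _ : Edge d L => haarProbability G := by
  set w : GaugeConfig d L G → ℝ := fun U => Real.exp (-β * wilsonAction ρ U) with hw
  have hwc : Continuous w :=
    Real.continuous_exp.comp (continuous_const.mul (continuous_wilsonAction ρ hρ))
  have hwm : Measurable w := hwc.measurable
  have hdm : Measurable fun U => ENNReal.ofReal (w U) := ENNReal.measurable_ofReal.comp hwm
  have hwi : Integrable w (Measure.pi fun _ : Edge d L => haarProbability G) :=
    hwc.integrable_of_hasCompactSupport (HasCompactSupport.of_compactSpace w)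
  have hw0 : ∀ U, 0 ≤ w U := fun U => (Real.exp_pos _).le
  have hZ : partitionFunction (d := d) (L := L) ρ β =
      ENNReal.ofReal (∫ U, w U ∂Measure.pi fun _ : Edge d L => haarProbability G) := by
    unfold partitionFunction wilsonWeight
    rw [withDensity_apply _ MeasurableSet.univ, Measure.restrict_univ,
      ofReal_integral_eq_lintegral_ofReal hwi (ae_of_all _ hw0)]
  unfold wilsonExpectation wilsonMeasure
  rw [integral_smul_measure, hZ, ENNReal.toReal_inv,
    ENNReal.toReal_ofReal (integral_nonneg hw0)]
  unfold wilsonWeight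
  rw [integral_withDensity_eq_integral_toReal_smul hdm (ae_of_all _ fun U => ENNReal.ofReal_lt_top)]
  simp_rw [ENNReal.toReal_ofReal (hw0 _), smul_eq_mul]
  rw [div_eq_inv_mul]
  congr 1
  exact integral_congr_ae (ae_of_all _ fun U => mul_comm _ _)

end Literature.MathematicalPhysics.QuantumFieldTheory
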